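/-
Copyright (c) 2026. All rights reserved.
Released under Apache 2.0 license as described in the file LICENSE.
Authors: abc-iut cell, prover seat abc-iut-w5-d172 (wave 5, gen 2).
-/
import Literature.IUT.LogVolume.WildCubicUnitLog
import HarnessLib

/-!
# Wild ramification: the `3`-adic logarithm of the unit `1 + π`, `π³ = 3`, is a UNIT (`‖log₃(1+π)‖ = 1`)

Proof-only companion (theorems, no definitions) of `WildCubicUnitLog.lean` (abc-iut cell,
`logSeries_one_add_pi`: `L(1+π) = π − π²/2 + 1 + R`, `‖R‖ ≤ ‖π‖²`). Classical local arithmetic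
(Neukirch, *Algebraic Number Theory*, Ch. II (5.5): the logarithm maps `U^{(n)}` isomorphically onto
`𝔭ⁿ` only for `n > e/(p−1)`; below that threshold the series has unit terms). For ANY complete
ultrametric normed `ℚ₃`-algebra field `K` containing `π` with `π³ = 3` (so `e(K/ℚ₃) ≥ 3 = p`):

* `norm_logSeries_one_add_pi_eq_one` — `‖L(1+π)‖ = 1`: the cubic term `π³/3 = 1` dominates;
* `norm_unitLog_one_add_pi_eq_one` — `‖log₃(1+π)‖ = 1` for abc-iut-S1's `unitLog = log₃`
  (`LocalUnitLog.lean`), i.e. `log₃(1+π) ∈ 𝒪_K^×`;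
* `exists_norm_unitLog_eq_one`, `logUnits_inter_sphere_nonempty`, `not_logUnits_subset_ball` —
  `log₃(𝒪_K^×) ⊄ 𝔪_K`: the image of the units under the logarithm MEETS the unit sphere.

This is the SHARPNESS of `UnitLogIntoMaximalIdeal.lean` (abc-iut-w5-d172 gen 0, p413571:
`e ≤ p − 1 ⇒ log_p(𝒪_K^×) ⊆ 𝔪_K`, `logUnits_inter_sphere_eq_empty`): at `e = p = 3` the conclusion
fails. Nothing here is disputed mathematics; no IUT statement is asserted.
-/

noncomputable section

open Metric Set

namespace Literature.IUT.LogVolume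

namespace WildCubic

variable {K : Type*} [NontriviallyNormedField K] [NormedAlgebra ℚ_[3] K] {π : K}

/-- `‖2‖ = 1` in a normed `ℚ₃`-algebra (`3 ∤ 2`). [cite: NeukirchANT1999, Ch. II (5.5)] -/
theorem norm_two : ‖(2 : K)‖ = 1 := by
  rw [show (2 : K) = ((2 : ℕ) : K) by norm_num, norm_natCast]
  have hle : ‖((2 : ℤ) : ℚ_[3])‖ ≤ 1 := Padic.norm_int_le_one 2
  have hnlt : ¬ ‖((2 : ℤ) : ℚ_[3])‖ < 1 := by
    rw [Padic.norm_intCast_lt_one_iff]; decide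
  have h : ‖((2 : ℤ) : ℚ_[3])‖ = 1 := le_antisymm hle (not_lt.mp hnlt)
  simpa using h

/-- `1 + π` is a principal unit: `‖1 − (1+π)‖ = ‖π‖ < 1`. [cite: NeukirchANT1999, Ch. II (5.3)] -/
theorem isPrincipal_one_add_pi (hπ : π ^ 3 = 3) : IsPrincipal (1 + π) := by
  show ‖1 - (1 + π)‖ < 1
  rw [show (1 : K) - (1 + π) = -π by ring, norm_neg]
  exact norm_pi_lt_one hπ

variable [IsUltrametricDist K]

/-- `‖1 + π‖ = 1`. [cite: NeukirchANT1999, Ch. II (5.3)] -/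
theorem norm_one_add_pi (hπ : π ^ 3 = 3) : ‖1 + π‖ = 1 :=
  (isPrincipal_one_add_pi hπ).norm_eq_one

variable [CompleteSpace K]

/-- **`‖L(1+π)‖ = 1`**: in `L(1+π) = π − π²/2 + 1 + R` (`WildCubicUnitLog.logSeries_one_add_pi`) the
terms `π`, `π²/2`, `R` have norm `< 1` and the cubic term `π³/3 = 1` has norm `1`, so the ultrametric
inequality gives norm exactly `1`. [cite: NeukirchANT1999, Ch. II (5.5)] -/
theorem norm_logSeries_one_add_pi_eq_one (hπ : π ^ 3 = 3) : ‖logSeries (1 + π)‖ = 1 := by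
  obtain ⟨R, hR, hL⟩ := logSeries_one_add_pi hπ
  have hπ1 : ‖π‖ < 1 := norm_pi_lt_one hπ
  have hπ0 : 0 ≤ ‖π‖ := norm_nonneg π
  have hπ2 : ‖π‖ ^ 2 < 1 := norm_pi_sq_lt_one hπ
  have hsq : ‖-(π ^ 2) / (2 : K)‖ < 1 := by
    rw [norm_div, norm_neg, norm_pow, norm_two, div_one]
    exact hπ2
  have hR1 : ‖R‖ < 1 := hR.trans_lt hπ2
  -- the non-unit part `π − π²/2 + R` has norm `< 1`
  have hsmall : ‖π + -(π ^ 2) / 2 + R‖ < 1 := by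
    refine lt_of_le_of_lt (IsUltrametricDist.norm_add_le_max _ _) (max_lt ?_ hR1)
    exact lt_of_le_of_lt (IsUltrametricDist.norm_add_le_max _ _) (max_lt hπ1 hsq)
  have hrw : logSeries (1 + π) = (π + -(π ^ 2) / 2 + R) + 1 := by rw [hL]; ring
  rw [hrw]
  have hne : ‖π + -(π ^ 2) / 2 + R‖ ≠ ‖(1 : K)‖ := by rw [norm_one]; exact hsmall.ne
  rw [IsUltrametricDist.norm_add_eq_max_of_norm_ne_norm hne, norm_one]
  exact max_eq_right hsmall.le

/-- **`‖log₃(1+π)‖ = 1`**: the `3`-adic logarithm (abc-iut-S1's `unitLog`) of the principal unit `1 + π`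
is a UNIT of `𝒪_K` — the wild phenomenon `log₃(𝒪_K^×) ⊄ 𝔪_K` at absolute ramification `e ≥ p`.
[cite: NeukirchANT1999, Ch. II (5.5)] -/
theorem norm_unitLog_one_add_pi_eq_one (hπ : π ^ 3 = 3) : ‖unitLog (1 + π)‖ = 1 := by
  rw [unitLog_of_isPrincipal 3 (isPrincipal_one_add_pi hπ)]
  exact norm_logSeries_one_add_pi_eq_one hπ

/-- There is a unit `u` of `𝒪_K` (namely `1 + π`) whose logarithm is again a unit.
[cite: NeukirchANT1999, Ch. II (5.5)] -/
theorem exists_norm_unitLog_eq_one (hπ : π ^ 3 = 3) : ∃ u : K, ‖u‖ = 1 ∧ ‖unitLog u‖ = 1 :=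
  ⟨1 + π, norm_one_add_pi hπ, norm_unitLog_one_add_pi_eq_one hπ⟩

/-- **`log₃(𝒪_K^×)` meets the unit sphere** (`logUnits K = unitLog '' {‖u‖ = 1}` of `LocalUnitLog.lean`):
contrast with `logUnits_inter_sphere_eq_empty` of `UnitLogIntoMaximalIdeal.lean` (`e ≤ p − 1`).
[cite: NeukirchANT1999, Ch. II (5.5)] -/
theorem logUnits_inter_sphere_nonempty (hπ : π ^ 3 = 3) : (logUnits K ∩ sphere 0 1).Nonempty :=
  ⟨unitLog (1 + π), unitLog_mem_logUnits (norm_one_add_pi hπ),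
    by rw [mem_sphere_zero_iff_norm]; exact norm_unitLog_one_add_pi_eq_one hπ⟩

/-- **`log₃(𝒪_K^×) ⊄ 𝔪_K`** (the open unit ball). [cite: NeukirchANT1999, Ch. II (5.5)] -/
theorem not_logUnits_subset_ball (hπ : π ^ 3 = 3) : ¬ logUnits K ⊆ ball 0 1 := by
  intro h
  have h1 := h (unitLog_mem_logUnits (norm_one_add_pi hπ))
  rw [mem_ball_zero_iff, norm_unitLog_one_add_pi_eq_one hπ] at h1
  exact lt_irrefl _ h1

/-- The SECOND iterate of `log₃` on units has NON-EMPTY domain and image: `log₃(log₃(1+π))` is a value of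
`log₃` on a unit lying in `log₃(𝒪_K^×)` — contrast with `unitLog_image_logUnits_inter_sphere_eq_empty`
(`e ≤ p − 1`) of `UnitLogIntoMaximalIdeal.lean`. [cite: NeukirchANT1999, Ch. II (5.5)] -/
theorem unitLog_image_logUnits_inter_sphere_nonempty (hπ : π ^ 3 = 3) :
    (unitLog '' (logUnits K ∩ sphere 0 1)).Nonempty :=
  (logUnits_inter_sphere_nonempty hπ).image _

end WildCubic

end Literature.IUT.LogVolume

end
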